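import Summits.QuantumFields.BalabanUV.T4Continuum.Support.VariationalVectorOneStepPhys

/-!
# T⁴ programme, spine node NE2 (U1a), lane P2 — SUPPLIER LEAF V-ONE FOR E-VALUED 1-FORMS («V-ONE-1F»), file 7: THE U = 1 ∕ TRANSPORT-FLAT INSTANCE —
# the printed (1.18) line-sum average and the flat curl form, PURELY ADDITIVE (`δ′ = 0`): non-vacuity of files 1–6's hypotheses

NE2 formalisation swarm `b2b-balaban-t4-ne2-formalise-*`, leaf prover 01 GEN 6 (`prover-b2b-balaban-t4-ne2-formalise-leaf-01-g6-0`); own-initiative corollary of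
file 5 `VariationalVectorOneStepPhys.blockSpin_Q1_le` (p219670) at FLAT data — all site frames, coarse and fine bond operators the identity — where the two frame
defects and the plaquette defect vanish (`m = p = 0`), the frame-adapted line transports are the identity (`frameT_one`) and the carrier is leaf-03-g4's U = 1
line-sum average `VectorBlockTrialForm.QvV` (`QvL_one_eq_QvV`; at `E = ℂ` literally the tree's `B5Block118.QvOp` of [Balaban1984PropagatorsI] (1.18) by
`QvV_eq_QvOp`).  THE STATEMENT (**`blockSpin_QvV_le_flat`**; every torus `M`, levels `n`, `n·L`, `E` a Hilbert space, any DATA `G ≥ 0` on the coarse side):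
    `blockSpin (QvV L (fine n M)) (SfV n L M 1 0) W ≤ ScV n M 1 G W + 4(d+26)·(L∕n²)·rhoV n M 1 W`
— the `hONE` binder of `VariationalVectorForm.vector_pair_bracket_sqrt` at flat data with `ε₁ = 4(d+26)·L∕n²` and `δ′ = 0` EXACTLY (the 1-form twin of leaf-02-g4's
`VariationalColourOneStepPhys.blockSpin_Q1v_le_flat`); `exists_oneStep_vector_flat` exhibits the competitor meeting the (1.18) constraint EXACTLY.

HONEST FRAMING (T4-DAG p. 1).  Model level (flat transports; the identification of `QvV` with (1.18) is the U = 1 SHAPE, c5); [folklore]; a corollary, no new estimate;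
no `def`, no `def … : Prop`, no `sorry`; axioms standard.  NE2 NOT proved; spine PROVED 0∕9; rung (B)+1 finite T⁴ — NOT infinite volume, NOT mass gap, NOT Clay.  HONEST
DEPENDENCY (cell, verbatim): continuum YM on T⁴ ⇐ BetaPertH ∧ nine spine estimates (0/9 proved); BetaPertH ⇐ (D1) ∧ (D4) ∧ CAP+tail; G-an2-4 gates asym, D1 and NE2/3/4.
-/

noncomputable section

namespace Summit.QuantumFields.BalabanUV.T4Continuum.VariationalVectorOneStepFlat

open Finset
open Literature.MathematicalPhysics.QuantumFieldTheory.Balaban1983to89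
open Literature.MathematicalPhysics.QuantumFieldTheory.Balaban1983to89.B5Prop11Plancherel (Tor fine unitVec)
open Literature.MathematicalPhysics.QuantumFieldTheory.Balaban1983to89.B5Block118 (tstep bpt)
open Summit.QuantumFields.BalabanUV.T4Continuum.VariationalTransfer (blockSpin blockSpin_le)
open Summit.QuantumFields.BalabanUV.T4Continuum.VectorBlockTrialForm (QvV QvL)
open Summit.QuantumFields.BalabanUV.T4Continuum.VariationalVectorForm (ScV SfV qWV ScV_nonneg SfV_nonneg)
open Summit.QuantumFields.BalabanUV.T4Continuum.VariationalVectorInterpolant (interpV frameT QvL_interpV)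
open Summit.QuantumFields.BalabanUV.T4Continuum.VariationalVectorOneStep (plaq)
open Summit.QuantumFields.BalabanUV.T4Continuum.VariationalVectorOneStepPhys (rhoV rhoV_nonneg SfV_interpV_le blockSpin_Q1_le)

variable {d : ℕ} {E : Type*} [NormedAddCommGroup E] [InnerProductSpace ℂ E] [CompleteSpace E]

/-! ## §1 Flat data: the frame-adapted line transports are the identity and the carrier is the (1.18) average -/

section Flat

variable (L : ℕ) [NeZero L] (N : Fin d → ℕ) [∀ μ, NeZero (N μ)]

omit [NeZero L] [∀ μ, NeZero (N μ)] [CompleteSpace E] in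
/-- at flat data the frame-adapted line transports are the identity. [folklore] -/
theorem frameT_one : frameT L N (fun _ => (1 : E →L[ℂ] E)) (fun _ _ => (1 : E →L[ℂ] E)) = fun _ _ _ _ => (1 : E →L[ℂ] E) := by
  funext y j t ν
  unfold frameT
  split_ifs <;> simp

omit [NeZero L] [∀ μ, NeZero (N μ)] [CompleteSpace E] in
/-- the line-indexed average with identity transports IS the U = 1 line-sum average `QvV` ([Balaban1984PropagatorsI] (1.18) SHAPE; `= QvOp *ᵥ` at `E = ℂ` by
`QvV_eq_QvOp`). [folklore] -/
theorem QvL_one_eq_QvV : QvL L N (fun _ _ _ _ => (1 : E →L[ℂ] E)) = QvV L N := by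
  funext W y μ
  simp only [QvL, QvV, one_apply_eq_self]

omit [∀ μ, NeZero (N μ)] [CompleteSpace E] in
/-- the flat plaquette defect vanishes. [folklore] -/
theorem plaq_one (y : Tor N) (μ ν : Fin d) : plaq N (fun _ _ => (1 : E →L[ℂ] E)) y μ ν = 0 := by
  unfold plaq; rw [mul_one, sub_self]

end Flat

/-! ## §2 The purely additive one-step bound at flat data -/

section Phys

variable (n L : ℕ) [NeZero n] [NeZero L] (M : Fin d → ℕ) [hM : ∀ μ, NeZero (M μ)]

/-- **LEAF V-ONE-1F AT FLAT DATA — PURELY ADDITIVE** (`hONE` with `ε₁ = 4(d+26)·L∕n²`, `δ′ = 0`): for every coarse 1-form `W` and any `G ≥ 0`,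
`blockSpin (QvV L (fine n M)) (SfV n L M 1 0) W ≤ ScV n M 1 G W + 4(d+26)·(L∕n²)·rhoV n M 1 W`. [folklore] -/
theorem blockSpin_QvV_le_flat {G : (Tor (fine n M) → Fin d → E) → ℝ} (hG0 : ∀ W, 0 ≤ G W) (W : Tor (fine n M) → Fin d → E) :
    blockSpin (QvV L (fine n M)) (SfV n L M (fun _ _ => (1 : E →L[ℂ] E)) (fun _ => 0)) W
      ≤ ScV n M (fun _ _ => (1 : E →L[ℂ] E)) G W + 4 * ((d : ℝ) + 26) * ((L : ℝ) / (n : ℝ) ^ 2) * rhoV n M (fun _ _ => (1 : E →L[ℂ] E)) W := by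
  have h1 : ∀ x : Tor (fine L (fine n M)), (fun _ => (1 : E →L[ℂ] E)) x ∈ unitary (E →L[ℂ] E) := fun _ => Submonoid.one_mem _
  have h2 : ∀ (y : Tor (fine n M)) (μ : Fin d), (fun _ _ => (1 : E →L[ℂ] E)) y μ ∈ unitary (E →L[ℂ] E) := fun _ _ => Submonoid.one_mem _
  have hin : ∀ (y : Tor (fine n M)) (j : Fin d → Fin L) (μ : Fin d), (j μ : ℕ) + 1 < L →
      ‖(fun _ _ => (1 : E →L[ℂ] E)) (bpt L (fine n M) y j) μ * star ((fun _ => (1 : E →L[ℂ] E)) (bpt L (fine n M) y j + unitVec (fine L (fine n M)) μ))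
        - star ((fun _ => (1 : E →L[ℂ] E)) (bpt L (fine n M) y j))‖ ≤ 0 := fun _ _ _ _ => by simp
  have hcross : ∀ (y : Tor (fine n M)) (j : Fin d → Fin L) (μ : Fin d), (j μ : ℕ) + 1 = L →
      ‖(fun _ _ => (1 : E →L[ℂ] E)) (bpt L (fine n M) y j) μ * star ((fun _ => (1 : E →L[ℂ] E)) (bpt L (fine n M) y j + unitVec (fine L (fine n M)) μ))
        - star ((fun _ => (1 : E →L[ℂ] E)) (bpt L (fine n M) y j)) * (fun _ _ => (1 : E →L[ℂ] E)) y μ‖ ≤ 0 := fun _ _ _ _ => by simp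
  have hp : ∀ (y : Tor (fine n M)) (μ ν : Fin d), ‖plaq (fine n M) (fun _ _ => (1 : E →L[ℂ] E)) y μ ν‖ ≤ 0 := fun y μ ν => by
    rw [plaq_one, norm_zero]
  have h := blockSpin_Q1_le n L M (R' := fun _ _ => (1 : E →L[ℂ] E)) h1 h2 le_rfl hin hcross hp hG0 W
  rw [frameT_one, QvL_one_eq_QvV] at h
  have hP : 0 ≤ ScV n M (fun _ _ => (1 : E →L[ℂ] E)) G W + 4 * ((d : ℝ) + 26) * ((L : ℝ) / (n : ℝ) ^ 2) * rhoV n M (fun _ _ => (1 : E →L[ℂ] E)) W := by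
    have := ScV_nonneg n M (fun _ _ => (1 : E →L[ℂ] E)) hG0 W; have := rhoV_nonneg n M (fun _ _ => (1 : E →L[ℂ] E)) W; positivity
  have hz : (n : ℝ) * L * Real.sqrt (d * (50 * (0 : ℝ) ^ 2 / L + (32 * (1 + (d : ℝ) ^ 2) + 400) * (0 : ℝ) ^ 2) / 2) * Real.sqrt (qWV n M W) = 0 := by
    simp
  rw [hz, add_zero, Real.sq_sqrt hP] at h
  exact h

/-- **THE FLAT COMPETITOR EXHIBITED**: `∃ W′, QvV W′ = W ∧ SfV n L M 1 0 W′ ≤ ScV n M 1 G W + 4(d+26)(L∕n²)·rhoV n M 1 W` — the tilted interpolant meets the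
printed (1.18) average constraint EXACTLY. [folklore] -/
theorem exists_oneStep_vector_flat {G : (Tor (fine n M) → Fin d → E) → ℝ} (hG0 : ∀ W, 0 ≤ G W) (W : Tor (fine n M) → Fin d → E) :
    ∃ W' : Tor (fine L (fine n M)) → Fin d → E, QvV L (fine n M) W' = W ∧
      SfV n L M (fun _ _ => (1 : E →L[ℂ] E)) (fun _ => 0) W'
        ≤ ScV n M (fun _ _ => (1 : E →L[ℂ] E)) G W + 4 * ((d : ℝ) + 26) * ((L : ℝ) / (n : ℝ) ^ 2) * rhoV n M (fun _ _ => (1 : E →L[ℂ] E)) W := by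
  have h1 : ∀ x : Tor (fine L (fine n M)), (fun _ => (1 : E →L[ℂ] E)) x ∈ unitary (E →L[ℂ] E) := fun _ => Submonoid.one_mem _
  have h2 : ∀ (y : Tor (fine n M)) (μ : Fin d), (fun _ _ => (1 : E →L[ℂ] E)) y μ ∈ unitary (E →L[ℂ] E) := fun _ _ => Submonoid.one_mem _
  have hin : ∀ (y : Tor (fine n M)) (j : Fin d → Fin L) (μ : Fin d), (j μ : ℕ) + 1 < L →
      ‖(fun _ _ => (1 : E →L[ℂ] E)) (bpt L (fine n M) y j) μ * star ((fun _ => (1 : E →L[ℂ] E)) (bpt L (fine n M) y j + unitVec (fine L (fine n M)) μ))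
        - star ((fun _ => (1 : E →L[ℂ] E)) (bpt L (fine n M) y j))‖ ≤ 0 := fun _ _ _ _ => by simp
  have hcross : ∀ (y : Tor (fine n M)) (j : Fin d → Fin L) (μ : Fin d), (j μ : ℕ) + 1 = L →
      ‖(fun _ _ => (1 : E →L[ℂ] E)) (bpt L (fine n M) y j) μ * star ((fun _ => (1 : E →L[ℂ] E)) (bpt L (fine n M) y j + unitVec (fine L (fine n M)) μ))
        - star ((fun _ => (1 : E →L[ℂ] E)) (bpt L (fine n M) y j)) * (fun _ _ => (1 : E →L[ℂ] E)) y μ‖ ≤ 0 := fun _ _ _ _ => by simp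
  have hp : ∀ (y : Tor (fine n M)) (μ ν : Fin d), ‖plaq (fine n M) (fun _ _ => (1 : E →L[ℂ] E)) y μ ν‖ ≤ 0 := fun y μ ν => by
    rw [plaq_one, norm_zero]
  refine ⟨interpV L (fine n M) (fun _ => (1 : E →L[ℂ] E)) (fun _ _ => 1) W, ?_, ?_⟩
  · have hQ := QvL_interpV L (fine n M) (fun _ _ => (1 : E →L[ℂ] E)) W h1
    rwa [frameT_one, QvL_one_eq_QvV] at hQ
  · have h := SfV_interpV_le n L M (R' := fun _ _ => (1 : E →L[ℂ] E)) h1 h2 le_rfl hin hcross hp hG0 W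
    have hP : 0 ≤ ScV n M (fun _ _ => (1 : E →L[ℂ] E)) G W + 4 * ((d : ℝ) + 26) * ((L : ℝ) / (n : ℝ) ^ 2) * rhoV n M (fun _ _ => (1 : E →L[ℂ] E)) W := by
      have := ScV_nonneg n M (fun _ _ => (1 : E →L[ℂ] E)) hG0 W; have := rhoV_nonneg n M (fun _ _ => (1 : E →L[ℂ] E)) W; positivity
    have hz : (n : ℝ) * L * Real.sqrt (d * (50 * (0 : ℝ) ^ 2 / L + (32 * (1 + (d : ℝ) ^ 2) + 400) * (0 : ℝ) ^ 2) / 2) * Real.sqrt (qWV n M W) = 0 := by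
      simp
    rw [hz, add_zero, Real.sq_sqrt hP] at h
    exact h

end Phys

end Summit.QuantumFields.BalabanUV.T4Continuum.VariationalVectorOneStepFlat

end
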